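import Summits.AtomisticToContinuum.BoseEinsteinCondensation.Theses.BECIntegerBlockRotor

/-!
# Birth skeleton (BC3) — crux `FillingContinuity` (stmt-AtomisticToContinuum-13594), route BECIntegerBlockRotor

LINE: ONE PARTICLE AT A TIME, TWO REGIMES.

`FillingContinuity` — `PCN v N' L ≤ PCN v N L + C·(N − N')` for all `N' ≤ N`, `0 < L`,
`N ≤ ρ₁ L³` (`PCN = periodicCondensateNumber`, the ground-state constant-mode occupation through
near-minimisers) — is the telescoping sum of ONE-PARTICLE STEPS
`PCN v M L ≤ PCN v (M+1) L + C`, `M = N', …, N − 1`, and the one-particle step needs two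
different engines according to the Gross–Pitaevskii coupling `(M+1)/L` of the box (the scattering
length of `v` is absorbed in `κ`):

* `stub_fewBodyStep` — SMALL-COUPLING GP WINDOW `M + 1 ≤ κ L` for SOME `κ = κ(v) > 0` and every
  `L > 0` (so `Ma/L ≤ κa`: the weak-coupling Gross–Pitaevskii regime and everything below it, boxes
  always `≥ 1/κ ≫` range of `v`). Here energy methods are legitimate — the interaction energy per
  particle `8πaM/L³ ≤ 8πaκ/L²` sits BELOW the kinetic gap `4π²/L²` once `κa` is small — and the step
  follows from BOUNDED DEPLETION `M − n₀ ≤ C` uniformly in the window (optimal-rate complete BEC on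
  the torus, Boccato–Brennecke–Cenatiempo–Schlein, Commun. Math. Phys. 359 (2018) 975 (small
  coupling, periodic b.c.) and 376 (2020) 1311, rescaled from the unit torus), together with
  `PCN v M L ≤ M`. Why it might fail: hard cores (`v = ⊤` on a ball; BBCS need `V ∈ L³`) and the
  uniformity of the depletion constant as the coupling `→ 0` / `M → 0` are not in print as stated.
* `stub_thermodynamicStep` — THERMODYNAMIC WINDOW `κ L ≤ M + 1 ≤ ρ₁ L³` for EVERY `κ > 0`
  (constants `C, ρ₁` may depend on `κ`): the research content of the crux — doping a dilute torus
  by one particle destroys at most `C` ground-state condensate particles, with no variational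
  handle (energy-window proofs are excluded by
  `Literature.Barriers.AtomisticToContinuum.KineticGapLengthScalesNarrow`: the slack `8πaρ` of one
  added particle exceeds the gap `4π²/L²` exactly when `M + 1 ≳ L/a`, i.e. in this window).

`FillingContinuity_of` is the glue, a real proof: take `κ` from the few-body stub, feed it to the
thermodynamic stub, use the common constant `max C₁ C₂`, and induct on `N − N'` with a regime
split at every step (ENNReal telescoping `ofReal C + ofReal (C k) = ofReal (C (k+1))`). Its
hypotheses are spelled `__Registered.stub_X` (`rfl`-aliases of the two statement defs keyed by the
stub names, the device of `Cruxes/AmplitudeLDP/Lines/birth.lean`, so that the native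
`#h21_check_skeleton` audit admits them by name); its conclusion is the route decl
`Summit.AtomisticToContinuum.BoseEinsteinCondensation.Theses.BECIntegerBlockRotor.FillingContinuity`
BY NAME; `#print axioms FillingContinuity_of` = [propext, Classical.choice, Quot.sound] (no `sorryAx`).

BC3 audit (planner folder `bc/`, 2026-08-17, farm `lean check --json`): this file rc 0, errors [],
sorries 2 = the two `stub_*` theorems, zero elsewhere. Probes: for each stub statement
`S ∈ {FewBodyStep, ThermodynamicStep}` both `S → FillingContinuity` and
`S → _root_.BoseEinsteinCondensation` by `first | exact? | simpa | simpa [S, T] | (unfold S T; simpa) |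
aesop | (unfold S T; aesop)` FAIL (combined: heartbeat exhaustion at 400000 / "aesop: failed to prove
the goal after exhaustive search"; each closer separately: `exact?` timeout resp. "could not close the
goal" after `intro/obtain`, `simpa` "assumption failed" ×3, `aesop` "failed after exhaustive search",
`unfold; aesop` rule limit, unsolved) — 22/22 probe examples fail: no stub is cheaply the crux or the
summit.

Disproof used: none on file (`ledger crux ls stmt-AtomisticToContinuum-13594`: no `Disproof.lean`,
no Negative lemmas, 2026-08-17). Negatives index: no BEC entry bears on either stub.
-/

namespace Summit.AtomisticToContinuum.BoseEinsteinCondensation.Cruxes.FillingContinuity.Birth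

open Summit.AtomisticToContinuum.BoseEinsteinCondensation.Theses.BECIntegerBlockRotor
open Literature.Barriers.AtomisticToContinuum.BoseGas (periodicCondensateNumber)

/-! ## The two stub statements -/

/-- **FewBodyStep (statement of stub 1; few-body / small-coupling GP window).** For every repulsive
finite-range `v` there are `C ≥ 0` and `κ > 0` such that on every torus of side `L > 0` holding
`N + 1 ≤ κ L` particles, adding one particle to the `N`-body ground state lowers the constant-mode
occupation by at most `C`: `PCN v N L ≤ PCN v (N+1) L + C`. Foreseen engine: bounded depletion
`N − n₀ ≤ C` uniformly in the window (optimal-rate BEC in the GP regime, BBCS 2018/2020, rescaled)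
and `PCN v N L ≤ N`. Size: L (hard cores and coupling-uniformity are the open edges). -/
def FewBodyStep : Prop :=
  ∀ v : ℝ → ENNReal,
    Literature.MathematicalPhysics.QuantumManyBody.BoseGas.IsRepulsiveFiniteRange v →
      ∃ C : ℝ, 0 ≤ C ∧ ∃ κ : ℝ, 0 < κ ∧ ∀ (N : ℕ) (L : ℝ), 0 < L → (N : ℝ) + 1 ≤ κ * L →
        Literature.Barriers.AtomisticToContinuum.BoseGas.periodicCondensateNumber v N L ≤
          Literature.Barriers.AtomisticToContinuum.BoseGas.periodicCondensateNumber v (N + 1) L +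
            ENNReal.ofReal C

/-- **ThermodynamicStep (statement of stub 2; thermodynamic window; the load-bearing stub).** For
every repulsive finite-range `v` and EVERY `κ > 0` there are `C ≥ 0` and `ρ₁ > 0` such that on every
torus of side `L > 0` with `κ L ≤ N + 1 ≤ ρ₁ L³`: `PCN v N L ≤ PCN v (N+1) L + C` — doping the dilute
periodic box by one particle removes at most `C` particles from the ground-state condensate
(Bogoliubov: it ADDS `1 − O(√(ρa³))`). Size: open-problem (the crux's research content, freed of the
few-body window and of the telescoping). -/
def ThermodynamicStep : Prop :=
  ∀ v : ℝ → ENNReal,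
    Literature.MathematicalPhysics.QuantumManyBody.BoseGas.IsRepulsiveFiniteRange v →
      ∀ κ : ℝ, 0 < κ → ∃ C : ℝ, 0 ≤ C ∧ ∃ ρ₁ : ℝ, 0 < ρ₁ ∧ ∀ (N : ℕ) (L : ℝ), 0 < L →
        κ * L ≤ (N : ℝ) + 1 → (N : ℝ) + 1 ≤ ρ₁ * L ^ 3 →
          Literature.Barriers.AtomisticToContinuum.BoseGas.periodicCondensateNumber v N L ≤
            Literature.Barriers.AtomisticToContinuum.BoseGas.periodicCondensateNumber v (N + 1) L +
              ENNReal.ofReal C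

/-! ## Registered stubs (the only `sorry`s of the file) -/

/-- stub 1: the one-particle step in the few-body / small-coupling GP window. -/
theorem stub_fewBodyStep : FewBodyStep := by
  sorry

/-- stub 2: the one-particle step in the thermodynamic window (hardest stub). -/
theorem stub_thermodynamicStep : ThermodynamicStep := by
  sorry

/-! ## Name-keyed aliases of the two stub statements — the hypotheses of `FillingContinuity_of`

The native skeleton audit (`#h21_check_skeleton`) admits a hypothesis of the skeleton theorem only if
its head constant is a registered obligation or is NAMED like a declared stub; `__Registered.stub_X`
is the statement of `stub_X` under that name (device of `Cruxes/AmplitudeLDP/Lines/birth.lean`).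
Each alias is `rfl`-equal to its statement def. -/
namespace __Registered

/-- Alias of `FewBodyStep` keyed by the registered stub name. -/
abbrev stub_fewBodyStep : Prop := FewBodyStep
/-- Alias of `ThermodynamicStep` keyed by the registered stub name. -/
abbrev stub_thermodynamicStep : Prop := ThermodynamicStep

end __Registered

/-! ## Composition: the crux BY NAME from the two stub statements (no `sorry` below) -/

/-- **Composition (real proof).** The two one-particle steps telescope to the crux
`FillingContinuity` BY NAME: common constant `max C₁ C₂`, density `ρ₁` from the thermodynamic stub
at the few-body stub's `κ`, induction on `N − N'` with a regime split at each step. -/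
theorem FillingContinuity_of (h₁ : __Registered.stub_fewBodyStep)
    (h₂ : __Registered.stub_thermodynamicStep) :
    Summit.AtomisticToContinuum.BoseEinsteinCondensation.Theses.BECIntegerBlockRotor.FillingContinuity := by
  intro v hv
  obtain ⟨C₁, hC₁, κ, hκ, hstep₁⟩ := h₁ v hv
  obtain ⟨C₂, hC₂, ρ₁, hρ₁, hstep₂⟩ := h₂ v hv κ hκ
  set C : ℝ := max C₁ C₂ with hCdef
  have hC : 0 ≤ C := le_max_of_le_left hC₁
  refine ⟨C, hC, ρ₁, hρ₁, ?_⟩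
  -- one particle at a time, with the common constant, in either regime
  have hone : ∀ (M : ℕ) (L : ℝ), 0 < L → (M : ℝ) + 1 ≤ ρ₁ * L ^ 3 →
      periodicCondensateNumber v M L ≤
        periodicCondensateNumber v (M + 1) L + ENNReal.ofReal C := by
    intro M L hL hM
    by_cases hreg : (M : ℝ) + 1 ≤ κ * L
    · calc periodicCondensateNumber v M L
          ≤ periodicCondensateNumber v (M + 1) L + ENNReal.ofReal C₁ := hstep₁ M L hL hreg
        _ ≤ periodicCondensateNumber v (M + 1) L + ENNReal.ofReal C := by
          gcongr
          exact le_max_left _ _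
    · have hreg' : κ * L ≤ (M : ℝ) + 1 := le_of_lt (not_le.mp hreg)
      calc periodicCondensateNumber v M L
          ≤ periodicCondensateNumber v (M + 1) L + ENNReal.ofReal C₂ := hstep₂ M L hL hreg' hM
        _ ≤ periodicCondensateNumber v (M + 1) L + ENNReal.ofReal C := by
          gcongr
          exact le_max_right _ _
  -- telescoping over k = N − N' added particles
  have htel : ∀ (k N' : ℕ) (L : ℝ), 0 < L → ((N' + k : ℕ) : ℝ) ≤ ρ₁ * L ^ 3 →
      periodicCondensateNumber v N' L ≤
        periodicCondensateNumber v (N' + k) L + ENNReal.ofReal (C * (k : ℝ)) := by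
    intro k
    induction k with
    | zero =>
      intro N' L _ _
      simp
    | succ k ih =>
      intro N' L hL h
      have hcast : ((N' + (k + 1) : ℕ) : ℝ) = ((N' + k : ℕ) : ℝ) + 1 := by
        push_cast
        ring
      have h1 : ((N' + k : ℕ) : ℝ) + 1 ≤ ρ₁ * L ^ 3 := hcast ▸ h
      have hk : ((N' + k : ℕ) : ℝ) ≤ ρ₁ * L ^ 3 := le_trans (by linarith) h1
      calc periodicCondensateNumber v N' L
          ≤ periodicCondensateNumber v (N' + k) L + ENNReal.ofReal (C * (k : ℝ)) := ih N' L hL hk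
        _ ≤ (periodicCondensateNumber v (N' + k + 1) L + ENNReal.ofReal C) +
              ENNReal.ofReal (C * (k : ℝ)) := by
          gcongr
          exact hone (N' + k) L hL h1
        _ = periodicCondensateNumber v (N' + (k + 1)) L +
              ENNReal.ofReal (C * ((k + 1 : ℕ) : ℝ)) := by
          rw [add_assoc, ← ENNReal.ofReal_add hC (mul_nonneg hC (Nat.cast_nonneg k))]
          have hring : C + C * (k : ℝ) = C * ((k + 1 : ℕ) : ℝ) := by
            push_cast
            ring
          rw [hring, ← Nat.add_assoc]
  intro N' N L hL hN'N hN
  obtain ⟨k, rfl⟩ := Nat.exists_eq_add_of_le hN'N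
  have hsub : ((N' + k : ℕ) : ℝ) - (N' : ℝ) = (k : ℝ) := by
    push_cast
    ring
  rw [hsub]
  exact htel k N' L hL hN

/-- Wiring check (an `example`, so that `FillingContinuity_of` stays the only theorem concluding the
crux): the registered stubs feed the skeleton theorem as stated — this term becomes the crux proof when
the two `sorry`s above are discharged (it carries `sorryAx` exactly through the two `stub_*`). -/
example : Summit.AtomisticToContinuum.BoseEinsteinCondensation.Theses.BECIntegerBlockRotor.FillingContinuity :=
  FillingContinuity_of stub_fewBodyStep stub_thermodynamicStep

/-- The plain-arrow form `FewBodyStep → ThermodynamicStep → FillingContinuity` (same proof term). -/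
example : FewBodyStep → ThermodynamicStep →
    Summit.AtomisticToContinuum.BoseEinsteinCondensation.Theses.BECIntegerBlockRotor.FillingContinuity :=
  FillingContinuity_of

end Summit.AtomisticToContinuum.BoseEinsteinCondensation.Cruxes.FillingContinuity.Birth
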